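import Summits.Ventures.WeilGRH.TrivialAtTwoTransfer
import Summits.Ventures.WeilGRH.BaseRungOddTransfer
import Summits.Ventures.WeilGRH.SmallConductorWindows
import HarnessLib

/-!
# GRH arm (rh-explicit, venture WeilGRH): transfer of a `ζ` rung through ONE prime power

For a window `[-a, a]` with `2a ≤ log 3` the only prime power that can enter the explicit formula
of `k = g ⋆ g̃` (supported in `[-2a, 2a] ⊆ [-log 3, log 3]`) is `n = 2`. Comparing Weil's functional
for a Dirichlet character `χ` mod `q ≠ 1` with the one for `ζ`:

`Q_χ(g) = Q_ζ(g) − [ĝ(0)conj ĝ(1) + ĝ(1)conj ĝ(0)] + (log q)‖g‖₂² + D + (parity term)`,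
`D = (Λ(2)/√2)·[(1 − χ(2)) k(log 2) + (1 − conj χ(2)) k(−log 2)]`,

and the three corrections are bounded by multiples of `‖g‖₂²`: the polar term by `2(sinh a + a)`
(`weilPolar_re_le`), `|D|` by `2√2·log 2` (Cauchy–Schwarz `|k(x)| ≤ ‖g‖₂²`, `|1 − χ(2)| ≤ 2`), and the
parity term is `≥ 0` (`arch_integral_par_zero_le_one`, odd `χ`). Hence the **one-prime transfer**:
if Weil positivity for `ζ` holds on `[-a, a]`, `2a ≤ log 3`, and
`2(sinh a + a) + 2√2 log 2 ≤ log q`, then `WeilPositivityOnChar χ a` for EVERY character `χ` mod `q`.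
At the `ζ` ladder's base rung `a = (log 3)/2` (Yoshida; kernel-checked in the tree) this gives
`WeilPositivityOnChar χ ((log 3)/2)` for every `χ` mod `q ≥ 81`.

No new analysis: Cauchy–Schwarz in the form `2|uv| ≤ |u|² + |v|²` plus translation invariance of
Lebesgue measure, `tsum_eq_single` for the one-term prime sums, and the transfer files'
bookkeeping identities.

## References

* A. Weil (1952), (11) and the «lemme» p. 262; H. Yoshida (1992), Thm 1 (the rung `(log 3)/2`).
-/

noncomputable section

open Complex Filter Set MeasureTheory
open scoped Real Topology ComplexConjugate ArithmeticFunction.vonMangoldt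

namespace Summit.Ventures.WeilGRH

open Literature.NumberTheory.LFunctions

variable {q : ℕ} {g : ℝ → ℂ}

/-! ## Cauchy–Schwarz for the autocorrelation -/

/-- **`|(g ⋆ g̃)(x)| ≤ ‖g‖₂²`** for a Weil test function `g` (Cauchy–Schwarz, here via
`2|g(u)||g(u−x)| ≤ |g(u)|² + |g(u−x)|²` and translation invariance of Lebesgue measure). [folklore] -/
theorem norm_weilConv_weilReflect_le (hg : IsWeilTest g) (x : ℝ) :
    ‖weilConv g (weilReflect g) x‖ ≤ ∫ t : ℝ, ‖g t‖ ^ 2 := by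
  have hgc : Continuous g := hg.1.continuous
  have hsh : Continuous fun u : ℝ ↦ g (u - x) := hgc.comp (continuous_id.sub continuous_const)
  have hI3 : Integrable (fun u : ℝ ↦ ‖g u‖ ^ 2) := by
    refine (hgc.norm.pow 2).integrable_of_hasCompactSupport ?_
    rw [pow_two]
    exact hg.2.norm.mul_right
  have hI4 : Integrable (fun u : ℝ ↦ ‖g (u - x)‖ ^ 2) := hI3.comp_sub_right x
  have hI1 : Integrable (fun u : ℝ ↦ ‖g u‖ * ‖g (u - x)‖) :=
    (hgc.norm.mul hsh.norm).integrable_of_hasCompactSupport hg.2.norm.mul_right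
  have hI2 : Integrable (fun u : ℝ ↦ (‖g u‖ ^ 2 + ‖g (u - x)‖ ^ 2) / 2) := (hI3.add hI4).div_const 2
  rw [weilConv_apply]
  calc ‖∫ u : ℝ, g u * weilReflect g (x - u)‖
      ≤ ∫ u : ℝ, ‖g u * weilReflect g (x - u)‖ := norm_integral_le_integral_norm _
    _ = ∫ u : ℝ, ‖g u‖ * ‖g (u - x)‖ := by
        congr 1 with u
        simp [weilReflect, neg_sub]
    _ ≤ ∫ u : ℝ, (‖g u‖ ^ 2 + ‖g (u - x)‖ ^ 2) / 2 :=
        integral_mono hI1 hI2 fun u ↦ by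
          have := two_mul_le_add_sq ‖g u‖ ‖g (u - x)‖
          simp only
          linarith
    _ = ((∫ u : ℝ, ‖g u‖ ^ 2) + ∫ u : ℝ, ‖g (u - x)‖ ^ 2) / 2 := by
        rw [integral_div, integral_add hI3 hI4]
    _ = ∫ t : ℝ, ‖g t‖ ^ 2 := by
        rw [integral_sub_right_eq_self (fun u : ℝ ↦ ‖g u‖ ^ 2) x]
        ring

/-! ## The one-term prime sums on the window `[-log 3, log 3]` -/

/-- On `[-log 3, log 3]` only `n = 2` can contribute to a prime sum: for `n ≠ 2` either `Λ(n) = 0`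
(`n = 0, 1`) or `k(± log n) = 0` (`n ≥ 3`, support). [folklore] -/
theorem vonMangoldt_eq_zero_or_apply_log_eq_zero {k : ℝ → ℂ} (hk : Continuous k)
    (h : tsupport k ⊆ Icc (-Real.log 3) (Real.log 3)) {n : ℕ} (hn : n ≠ 2) :
    ((Λ n : ℝ) : ℂ) = 0 ∨ (k (Real.log n) = 0 ∧ k (-Real.log n) = 0) := by
  have hsupp := support_subset_Ioo_of_tsupport_subset_Icc hk h
  rcases Nat.lt_or_ge n 3 with h3 | h3
  · left
    interval_cases n
    · simp
    · simp
    · exact absurd rfl hn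
  · right
    have hlog : Real.log 3 ≤ Real.log n :=
      Real.log_le_log (by norm_num) (by exact_mod_cast h3)
    constructor
    · by_contra hne
      have := (hsupp hne).2
      linarith
    · by_contra hne
      have := (hsupp hne).1
      linarith

/-- The difference of the `ζ` and `χ` prime terms on `[-log 3, log 3]` is the single `n = 2` term
`D = (Λ(2)/√2)·[(1 − χ(2)) k(log 2) + (1 − conj χ(2)) k(−log 2)]`. [cite: Weil1952FormulesExplicites, (11) pp. 261–262, prime term] -/
theorem weilPrimeTerm_sub_weilPrimeTermChar (χ : DirichletCharacter ℂ q) {k : ℝ → ℂ}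
    (hk : Continuous k) (h : tsupport k ⊆ Icc (-Real.log 3) (Real.log 3)) :
    weilPrimeTerm k - weilPrimeTermChar χ k =
      ((Λ 2 : ℝ) : ℂ) / (Real.sqrt (2 : ℕ) : ℂ) *
        ((1 - χ ((2 : ℕ) : ZMod q)) * k (Real.log (2 : ℕ)) +
          (1 - conj (χ ((2 : ℕ) : ZMod q))) * k (-Real.log (2 : ℕ))) := by
  have hz := fun n (hn : n ≠ 2) ↦ vonMangoldt_eq_zero_or_apply_log_eq_zero hk h hn
  have h1 : weilPrimeTerm k =
      ((Λ 2 : ℝ) : ℂ) / (Real.sqrt (2 : ℕ) : ℂ) * (k (Real.log (2 : ℕ)) + k (-Real.log (2 : ℕ))) := by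
    unfold weilPrimeTerm
    refine tsum_eq_single 2 fun n hn ↦ ?_
    rcases hz n hn with h0 | ⟨ha, hb⟩
    · simp [h0]
    · simp [ha, hb]
  have h2 : weilPrimeTermChar χ k =
      ((Λ 2 : ℝ) : ℂ) / (Real.sqrt (2 : ℕ) : ℂ) *
        (χ ((2 : ℕ) : ZMod q) * k (Real.log (2 : ℕ)) +
          conj (χ ((2 : ℕ) : ZMod q)) * k (-Real.log (2 : ℕ))) := by
    unfold weilPrimeTermChar
    refine tsum_eq_single 2 fun n hn ↦ ?_
    rcases hz n hn with h0 | ⟨ha, hb⟩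
    · simp [h0]
    · simp [ha, hb]
  rw [h1, h2]
  ring

/-- **Bound on the one-prime correction**: `|Re D| ≤ ‖D‖ ≤ 2√2 log 2 · ‖g‖₂²` for `k = g ⋆ g̃`
supported in `[-log 3, log 3]` (`Λ(2) = log 2`, `|1 − χ(2)| ≤ 2`, `|k(± log 2)| ≤ ‖g‖₂²`). [folklore] -/
theorem norm_weilPrimeTerm_sub_weilPrimeTermChar_le (χ : DirichletCharacter ℂ q) (hg : IsWeilTest g)
    (h : tsupport (weilConv g (weilReflect g)) ⊆ Icc (-Real.log 3) (Real.log 3)) :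
    ‖weilPrimeTerm (weilConv g (weilReflect g)) - weilPrimeTermChar χ (weilConv g (weilReflect g))‖ ≤
      2 * Real.sqrt 2 * Real.log 2 * ∫ t : ℝ, ‖g t‖ ^ 2 := by
  set k := weilConv g (weilReflect g) with hk
  have hkc : Continuous k := (hg.weilConv hg.weilReflect).1.continuous
  set N : ℝ := ∫ t : ℝ, ‖g t‖ ^ 2 with hN
  have hN0 : 0 ≤ N := integral_nonneg fun t ↦ by positivity
  have hk1 : ‖k (Real.log (2 : ℕ))‖ ≤ N := norm_weilConv_weilReflect_le hg _
  have hk2 : ‖k (-Real.log (2 : ℕ))‖ ≤ N := norm_weilConv_weilReflect_le hg _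
  have hχ2 : ‖χ ((2 : ℕ) : ZMod q)‖ ≤ 1 := DirichletCharacter.norm_le_one χ _
  have hc1 : ‖1 - χ ((2 : ℕ) : ZMod q)‖ ≤ 2 := by
    calc ‖1 - χ ((2 : ℕ) : ZMod q)‖ ≤ ‖(1 : ℂ)‖ + ‖χ ((2 : ℕ) : ZMod q)‖ := norm_sub_le _ _
      _ ≤ 2 := by rw [norm_one]; linarith
  have hc2 : ‖1 - conj (χ ((2 : ℕ) : ZMod q))‖ ≤ 2 := by
    rw [show (1 : ℂ) - conj (χ ((2 : ℕ) : ZMod q)) = conj (1 - χ ((2 : ℕ) : ZMod q)) by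
      rw [map_sub, map_one], Complex.norm_conj]
    exact hc1
  have hΛ : ((Λ 2 : ℝ) : ℂ) / (Real.sqrt (2 : ℕ) : ℂ) = ((Real.log 2 / Real.sqrt 2 : ℝ) : ℂ) := by
    rw [ArithmeticFunction.vonMangoldt_apply_prime Nat.prime_two]
    push_cast
    ring
  have hcoef : ‖((Real.log 2 / Real.sqrt 2 : ℝ) : ℂ)‖ = Real.log 2 / Real.sqrt 2 := by
    rw [Complex.norm_real, Real.norm_eq_abs, abs_of_nonneg]
    exact div_nonneg (Real.log_nonneg (by norm_num)) (Real.sqrt_nonneg _)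
  have hsq : Real.sqrt 2 * Real.sqrt 2 = 2 := Real.mul_self_sqrt (by norm_num)
  have hs0 : 0 < Real.sqrt 2 := by positivity
  have hl0 : 0 ≤ Real.log 2 := Real.log_nonneg (by norm_num)
  rw [weilPrimeTerm_sub_weilPrimeTermChar χ hkc h, hΛ, norm_mul, hcoef]
  have hin : ‖(1 - χ ((2 : ℕ) : ZMod q)) * k (Real.log (2 : ℕ)) +
      (1 - conj (χ ((2 : ℕ) : ZMod q))) * k (-Real.log (2 : ℕ))‖ ≤ 2 * N + 2 * N := by
    refine (norm_add_le _ _).trans (add_le_add ?_ ?_)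
    · rw [norm_mul]
      exact mul_le_mul hc1 hk1 (norm_nonneg _) (by norm_num)
    · rw [norm_mul]
      exact mul_le_mul hc2 hk2 (norm_nonneg _) (by norm_num)
  have hkey : Real.log 2 / Real.sqrt 2 * (2 * N + 2 * N) = 2 * Real.sqrt 2 * Real.log 2 * N := by
    field_simp
    nlinarith [hsq]
  calc Real.log 2 / Real.sqrt 2 *
        ‖(1 - χ ((2 : ℕ) : ZMod q)) * k (Real.log (2 : ℕ)) +
          (1 - conj (χ ((2 : ℕ) : ZMod q))) * k (-Real.log (2 : ℕ))‖
      ≤ Real.log 2 / Real.sqrt 2 * (2 * N + 2 * N) :=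
        mul_le_mul_of_nonneg_left hin (div_nonneg hl0 hs0.le)
    _ = 2 * Real.sqrt 2 * Real.log 2 * N := hkey

/-! ## The transfer theorems -/

/-- **One-prime transfer, even characters.** `2a ≤ log 3`, `q ≠ 1`, `χ` even,
Weil positivity for `ζ` on `[-a, a]`, and `2(sinh a + a) + 2√2·log 2 ≤ log q` ⟹
`WeilPositivityOnChar χ a`: `Re Q_χ(g) = Re Q_ζ(g) − 2Re(ĝ(0)conj ĝ(1)) + (log q)‖g‖₂² + Re D ≥ 0`.
[cite: Weil1952FormulesExplicites, (11) and the «lemme» p. 262; Yoshida1992, §6 (6.2)] -/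
theorem weilPositivityOnChar_of_even_one_prime {a : ℝ} (ha : 2 * a ≤ Real.log 3)
    (hζ : WeilPositivityOn a) (hq1 : q ≠ 1)
    (hq : 2 * (Real.sinh a + a) + 2 * Real.sqrt 2 * Real.log 2 ≤ Real.log q)
    (χ : DirichletCharacter ℂ q) (hχ : χ.Even) :
    WeilPositivityOnChar χ a := by
  intro g hg hsupp
  set k := weilConv g (weilReflect g) with hk
  have hkt : IsWeilTest k := hg.weilConv hg.weilReflect
  have hks : tsupport k ⊆ Icc (-Real.log 3) (Real.log 3) :=
    (tsupport_weilConv_weilReflect_subset hg.2 hsupp).trans (Icc_subset_Icc (by linarith) ha)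
  set N : ℝ := ∫ t : ℝ, ‖g t‖ ^ 2 with hN
  set P : ℝ := 2 * (weilMellin g 0 * conj (weilMellin g 1)).re with hP
  set D : ℂ := weilPrimeTerm k - weilPrimeTermChar χ k with hD
  have hQ : weilQuadraticChar χ g =
      weilQuadratic g - weilPolarTerm k + k 0 * (Real.log q : ℂ) + D := by
    show weilFunctionalChar χ k = weilFunctional k - weilPolarTerm k + k 0 * (Real.log q : ℂ) + D
    rw [hD]
    unfold weilFunctionalChar weilFunctional weilArchTermChar weilArchTerm
    rw [if_neg hq1, charParity_of_even hχ, weilArchIntegralChar_zero]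
    push_cast
    ring
  have hre : (weilQuadraticChar χ g).re = (weilQuadratic g).re - P + N * Real.log q + D.re := by
    rw [hQ, hk, weilPolarTerm_weilConv_weilReflect hg, weilConv_weilReflect_apply_zero, hP, hN]
    simp only [sub_re, add_re, Complex.ofReal_re, mul_re, Complex.ofReal_im, mul_zero,
      sub_zero]
  have hζg : 0 ≤ (weilQuadratic g).re := hζ g hg hsupp
  have hPle : P ≤ 2 * (Real.sinh a + a) * N := weilPolar_re_le hg hsupp
  have hN0 : 0 ≤ N := integral_nonneg fun t ↦ by positivity
  have hDn : ‖D‖ ≤ 2 * Real.sqrt 2 * Real.log 2 * N :=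
    norm_weilPrimeTerm_sub_weilPrimeTermChar_le χ hg hks
  have hDre : -(2 * Real.sqrt 2 * Real.log 2 * N) ≤ D.re := by
    have := (abs_le.1 (Complex.abs_re_le_norm D)).1
    linarith
  rw [hre]
  nlinarith [mul_le_mul_of_nonneg_right hq hN0]

/-- **One-prime transfer, odd characters** (`[NeZero q]`): as the even case plus the parity term
`(1/2π)(A₁ − A₀) ≥ 0` of the odd archimedean factor (`arch_integral_par_zero_le_one`).
[cite: Weil1952FormulesExplicites, (11) and the «lemme» p. 262; Yoshida1992, §6 (6.2)] -/
theorem weilPositivityOnChar_of_odd_one_prime [NeZero q] {a : ℝ} (ha : 2 * a ≤ Real.log 3)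
    (hζ : WeilPositivityOn a) (hq1 : q ≠ 1)
    (hq : 2 * (Real.sinh a + a) + 2 * Real.sqrt 2 * Real.log 2 ≤ Real.log q)
    (χ : DirichletCharacter ℂ q) (hχ : χ.Odd) :
    WeilPositivityOnChar χ a := by
  intro g hg hsupp
  set k := weilConv g (weilReflect g) with hk
  have hkt : IsWeilTest k := hg.weilConv hg.weilReflect
  have hks : tsupport k ⊆ Icc (-Real.log 3) (Real.log 3) :=
    (tsupport_weilConv_weilReflect_subset hg.2 hsupp).trans (Icc_subset_Icc (by linarith) ha)
  set N : ℝ := ∫ t : ℝ, ‖g t‖ ^ 2 with hN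
  set P : ℝ := 2 * (weilMellin g 0 * conj (weilMellin g 1)).re with hP
  set D : ℂ := weilPrimeTerm k - weilPrimeTermChar χ k with hD
  set A0 : ℝ := ∫ t : ℝ, ‖weilMellin g (1 / 2 + t * I)‖ ^ 2 *
    (Complex.digamma (1 / 4 + ((0 : ℕ) : ℂ) / 2 + t / 2 * I)).re with hA0
  set A1 : ℝ := ∫ t : ℝ, ‖weilMellin g (1 / 2 + t * I)‖ ^ 2 *
    (Complex.digamma (1 / 4 + ((1 : ℕ) : ℂ) / 2 + t / 2 * I)).re with hA1
  have hI0 : weilArchIntegral k = (A0 : ℂ) := by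
    rw [← weilArchIntegralChar_zero, hk, weilArchIntegralChar_weilConv_weilReflect hg 0]
  have hI1 : weilArchIntegralChar 1 k = (A1 : ℂ) := by
    rw [hk, weilArchIntegralChar_weilConv_weilReflect hg 1]
  have hQ : weilQuadraticChar χ g =
      weilQuadratic g - weilPolarTerm k + k 0 * (Real.log q : ℂ) + D +
        (1 / (2 * π) : ℂ) * ((A1 : ℂ) - (A0 : ℂ)) := by
    show weilFunctionalChar χ k = weilFunctional k - weilPolarTerm k + k 0 * (Real.log q : ℂ) + D +
        (1 / (2 * π) : ℂ) * ((A1 : ℂ) - (A0 : ℂ))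
    rw [hD]
    unfold weilFunctionalChar weilFunctional weilArchTermChar weilArchTerm
    rw [if_neg hq1, charParity_of_odd hχ, hI1, hI0]
    push_cast
    ring
  have hπ : ((1 / (2 * π) : ℂ)) = ((1 / (2 * π) : ℝ) : ℂ) := by push_cast; ring
  have hre : (weilQuadraticChar χ g).re =
      (weilQuadratic g).re - P + N * Real.log q + D.re + 1 / (2 * π) * (A1 - A0) := by
    rw [hQ, hπ, hk, weilPolarTerm_weilConv_weilReflect hg, weilConv_weilReflect_apply_zero, hP, hN]
    simp only [sub_re, add_re, Complex.ofReal_re, mul_re, Complex.ofReal_im, mul_zero,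
      sub_zero, zero_mul]
  have hζg : 0 ≤ (weilQuadratic g).re := hζ g hg hsupp
  have hPle : P ≤ 2 * (Real.sinh a + a) * N := weilPolar_re_le hg hsupp
  have hN0 : 0 ≤ N := integral_nonneg fun t ↦ by positivity
  have hDn : ‖D‖ ≤ 2 * Real.sqrt 2 * Real.log 2 * N :=
    norm_weilPrimeTerm_sub_weilPrimeTermChar_le χ hg hks
  have hDre : -(2 * Real.sqrt 2 * Real.log 2 * N) ≤ D.re := by
    have := (abs_le.1 (Complex.abs_re_le_norm D)).1
    linarith
  have hA : A0 ≤ A1 := arch_integral_par_zero_le_one hg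
  have hπ0 : 0 ≤ 1 / (2 * π) := by positivity
  rw [hre]
  nlinarith [mul_le_mul_of_nonneg_right hq hN0, mul_nonneg hπ0 (sub_nonneg.2 hA)]

/-- **ONE-PRIME TRANSFER (any parity).** `2a ≤ log 3`, `q ≠ 1`, Weil positivity for `ζ` on
`[-a, a]`, `2(sinh a + a) + 2√2·log 2 ≤ log q` ⟹ `WeilPositivityOnChar χ a` for EVERY Dirichlet
character `χ` mod `q`. [cite: Weil1952FormulesExplicites, (11) and the «lemme» p. 262; Yoshida1992, §6 (6.2)] -/
theorem weilPositivityOnChar_transfer_one_prime [NeZero q] {a : ℝ} (ha : 2 * a ≤ Real.log 3)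
    (hζ : WeilPositivityOn a) (hq1 : q ≠ 1)
    (hq : 2 * (Real.sinh a + a) + 2 * Real.sqrt 2 * Real.log 2 ≤ Real.log q)
    (χ : DirichletCharacter ℂ q) : WeilPositivityOnChar χ a := by
  rcases χ.even_or_odd with h | h
  · exact weilPositivityOnChar_of_even_one_prime ha hζ hq1 hq χ h
  · exact weilPositivityOnChar_of_odd_one_prime ha hζ hq1 hq χ h

/-! ## The rung `(log 3)/2` for every character mod `q ≥ 81` -/

/-- Numerics: `2/√3 + log 3 + 2√2·log 2 ≤ log 81 = 4 log 3` — from `2/√3 < 6/5`, `√2 < 17/12`,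
`log 2 < 7/10` (`2¹⁰ < e⁷`), `log 3 > 1.089`. [folklore] -/
theorem one_prime_numerics_log_three_half :
    2 * (1 / Real.sqrt 3 + Real.log 3 / 2) + 2 * Real.sqrt 2 * Real.log 2 ≤ Real.log 81 := by
  have hs3 : (5 / 3 : ℝ) < Real.sqrt 3 := by
    rw [show (5 / 3 : ℝ) = Real.sqrt ((5 / 3) ^ 2) by rw [Real.sqrt_sq (by norm_num)]]
    exact Real.sqrt_lt_sqrt (by norm_num) (by norm_num)
  have h1 : 1 / Real.sqrt 3 < 3 / 5 := by
    rw [div_lt_iff₀ (by positivity)]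
    nlinarith
  have hs2 : Real.sqrt 2 < 17 / 12 := by
    rw [show (17 / 12 : ℝ) = Real.sqrt ((17 / 12) ^ 2) by rw [Real.sqrt_sq (by norm_num)]]
    exact Real.sqrt_lt_sqrt (by norm_num) (by norm_num)
  have he : (2.7182818283 : ℝ) < Real.exp 1 := Real.exp_one_gt_d9
  have hl2 : Real.log 2 < 7 / 10 := by
    rw [Real.log_lt_iff_lt_exp (by norm_num)]
    have h7 : Real.exp 7 = Real.exp 1 ^ 7 := by rw [← Real.exp_nat_mul]; norm_num
    have h710 : Real.exp (7 / 10) ^ 10 = Real.exp 7 := by rw [← Real.exp_nat_mul]; norm_num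
    have hp : (2.7182818283 : ℝ) ^ 7 < Real.exp 1 ^ 7 := pow_lt_pow_left₀ he (by norm_num) (by norm_num)
    have hn : (2 : ℝ) ^ 10 < (2.7182818283 : ℝ) ^ 7 := by norm_num
    have hlt : (2 : ℝ) ^ 10 < Real.exp (7 / 10) ^ 10 := by rw [h710, h7]; linarith
    exact lt_of_pow_lt_pow_left₀ 10 (Real.exp_pos _).le hlt
  have hl3 : (1.089 : ℝ) < Real.log 3 := log_three_gt
  have h81 : Real.log 81 = 4 * Real.log 3 := by
    rw [show (81 : ℝ) = 3 ^ 4 by norm_num, Real.log_pow]; norm_num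
  have hl20 : 0 ≤ Real.log 2 := Real.log_nonneg (by norm_num)
  have hs20 : 0 ≤ Real.sqrt 2 := Real.sqrt_nonneg _
  have hprod : Real.sqrt 2 * Real.log 2 ≤ 17 / 12 * (7 / 10) :=
    mul_le_mul hs2.le hl2.le hl20 (by norm_num)
  rw [h81]
  nlinarith [hprod]

/-- **The `ζ` base rung `(log 3)/2` transfers to EVERY Dirichlet character mod `q ≥ 81`**:
`WeilPositivityOnChar χ ((log 3)/2)` (Yoshida's rung `weilPositivityOn_log_three_half`, kernel-checked
in the tree, through the one-prime transfer; `sinh((log 3)/2) = 1/√3`).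
[cite: Weil1952FormulesExplicites, (11) and the «lemme» p. 262; Yoshida1992, Thm 1 (p. 310)] -/
theorem weilPositivityOnChar_log_three_half_of_ge_81 (hq : 81 ≤ q) (χ : DirichletCharacter ℂ q) :
    WeilPositivityOnChar χ (Real.log 3 / 2) := by
  have hq1 : q ≠ 1 := by omega
  haveI : NeZero q := ⟨by omega⟩
  refine weilPositivityOnChar_transfer_one_prime (by linarith) weilPositivityOn_log_three_half hq1 ?_ χ
  have hlogq : Real.log 81 ≤ Real.log q :=
    Real.log_le_log (by norm_num) (by exact_mod_cast hq)
  rw [sinh_log_three_half]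
  linarith [one_prime_numerics_log_three_half]

end Summit.Ventures.WeilGRH
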